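import Summits.CriticalPhenomena.CardyFormulaZ2.Theorems.CardySelfRefinementLagHandOffDiscreteLocalityMesh
import Summits.CriticalPhenomena.CardyFormulaZ2.Theorems.CardySelfRefinementLagHandOffDiscreteLocalityGeometry
import HarnessLib

/-!
# Patching the labellings of nested domains, I (the cut edges): helper for stub `stub_discreteLocality`
(R3a) of line `hitting-tournament` for crux `LagHandOff` (stmt-CriticalPhenomena-10268)

One mesh, lattice combinatorics and metric bookkeeping.  Let `D'' ⊆ D` be Dobrushin domains with the
same marked points `a, b`, compatible arcs (`exists_arcCompatible'`), `a` far from the removed part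
`F = closure (D ∖ D'')` and `b` either in `F` or far from it.  Given a labelling `SA ⊔ SB` of the
square-lattice boundary of `Ω_δ(D)` (sides within `ε` of the arcs of `D`, cut edges `e_a`, `e_b`
near `a`, `b`) and a labelling `SA' ⊔ SB'` of the boundary of `Ω_δ(D'')` (same, for `D''`, cut edges
`e_a'`, `e_b'`), the PATCHED labelling `P ⊔ Q` of the boundary of `Ω_δ(D'')` — `P` = the `SA`-sites
`θ`-far from `F` together with the `SA'`-sites not `θ`-far from `F` — has sides within `ε` of the
arcs of `D''` and EXACTLY the cut edges `e_a` and `e_b` (if `b` is far from `F`) or `e_b'` (if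
`b ∈ F`), each a side of exactly one inner face; it agrees with `SA ⊔ SB` at every `θ`-far site
(`locality_patch_cut`).  Inputs: lattice locality (`…DiscreteLocalityLattice/Mesh.lean`) at the far
sites, separation of the two arcs away from `a, b` (`…DiscreteLocalityGeometry.lean`) at the seam.
The no-forcing property of the patch is in part II (`…DiscreteLocalityPatch.lean`).
-/

noncomputable section

open Set Metric
open Literature.Probability.LatticeModels Literature.Probability.Percolation
  Literature.Probability.RandomPlanarGeometry
open Summit.CriticalPhenomena.CardyFormulaZ2.Theorems.DiscretisationFamilyExists

namespace Summit.CriticalPhenomena.CardyFormulaZ2.Cruxes.LagHandOff.HittingTournament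

set_option maxHeartbeats 3200000 in
/-- **Patching the labellings of nested domains, I: sides, cut edges, agreement.** See the module docstring. -/
theorem locality_patch_cut (D D'' : DobrushinDomain) (hsub : D''.carrier ⊆ D.carrier)
    (hA0 : ∀ z ∈ D.arc 0, z ∉ closure (D.carrier \ D''.carrier) → z ∈ D''.arc 0)
    (hA1 : ∀ z ∈ D.arc 1, z ∉ closure (D.carrier \ D''.carrier) → z ∈ D''.arc 1)
    {δ ε θ μ : ℝ} (hδ : 0 < δ)
    (hμ : ∀ z : ℂ, θ / 2 ≤ dist z (D.pt 0) → θ / 2 ≤ dist z (D.pt 1) →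
      infDist z (D''.arc 0) ≤ μ → infDist z (D''.arc 1) ≤ μ → False)
    (ha : ∀ z ∈ closure (D.carrier \ D''.carrier), 3 * θ ≤ dist (D.pt 0) z)
    (hb : D.pt 1 ∈ closure (D.carrier \ D''.carrier) ∨
      ∀ z ∈ closure (D.carrier \ D''.carrier), 3 * θ ≤ dist (D.pt 1) z)
    (hab : 2 * θ ≤ dist (D.pt 0) (D.pt 1)) (hεμ : ε + 2 * δ ≤ μ) (hδθ : 16 * δ ≤ θ) (hεθ : 4 * ε ≤ θ)
    (hMM : ∀ v : Site 2, (∀ z ∈ closure (D.carrier \ D''.carrier), θ / 4 ≤ dist (meshPoint δ v) z) →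
      (v ∈ meshDomain D.carrier δ ↔ v ∈ meshDomain D''.carrier δ))
    {SA SB SA' SB' P Q : Set (Site 2)} {ea eb ea' eb' : Sym2 (Site 2)}
    (hU : SA ∪ SB = (⟨D.carrier, δ, ∅, ∅⟩ : DiscreteDobrushin).zdBoundary) (hdj : Disjoint SA SB)
    (hsA : ∀ y ∈ SA, infDist (meshPoint δ y) (D.arc 0) ≤ ε)
    (hsB : ∀ x ∈ SB, infDist (meshPoint δ x) (D.arc 1) ≤ ε)
    (hAB : {e | e ∈ (discreteDomainGraph D.carrier δ).edgeSet ∧ (∃ x ∈ e, x ∈ SA) ∧ ∃ y ∈ e, y ∈ SB} =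
      {ea, eb})
    (hea : dist (medialPoint δ ea) (D.pt 0) ≤ ε) (heb : dist (medialPoint δ eb) (D.pt 1) ≤ ε)
    (hinner : ∀ e ∈ (discreteDomainGraph D.carrier δ).edgeSet, (∃ x ∈ e, x ∈ SA) → (∃ y ∈ e, y ∈ SB) →
      ∃! f, (⟨D.carrier, δ, ∅, ∅⟩ : DiscreteDobrushin).IsInnerFace f ∧ ∀ x ∈ e, IsCorner x f)
    (hU' : SA' ∪ SB' = (⟨D''.carrier, δ, ∅, ∅⟩ : DiscreteDobrushin).zdBoundary) (hdj' : Disjoint SA' SB')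
    (hsA' : ∀ y ∈ SA', infDist (meshPoint δ y) (D''.arc 0) ≤ ε)
    (hsB' : ∀ x ∈ SB', infDist (meshPoint δ x) (D''.arc 1) ≤ ε)
    (hAB' : {e | e ∈ (discreteDomainGraph D''.carrier δ).edgeSet ∧ (∃ x ∈ e, x ∈ SA') ∧ ∃ y ∈ e, y ∈ SB'} =
      {ea', eb'})
    (hea' : dist (medialPoint δ ea') (D.pt 0) ≤ ε) (heb' : dist (medialPoint δ eb') (D.pt 1) ≤ ε)
    (hinner' : ∀ e ∈ (discreteDomainGraph D''.carrier δ).edgeSet, (∃ x ∈ e, x ∈ SA') → (∃ y ∈ e, y ∈ SB') →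
      ∃! f, (⟨D''.carrier, δ, ∅, ∅⟩ : DiscreteDobrushin).IsInnerFace f ∧ ∀ x ∈ e, IsCorner x f)
    (hP : P = {y | y ∈ (⟨D''.carrier, δ, ∅, ∅⟩ : DiscreteDobrushin).zdBoundary ∧
      ((y ∈ SA ∧ ∀ z ∈ closure (D.carrier \ D''.carrier), θ ≤ dist (meshPoint δ y) z) ∨
        (y ∈ SA' ∧ ¬ ∀ z ∈ closure (D.carrier \ D''.carrier), θ ≤ dist (meshPoint δ y) z))})
    (hQ : Q = (⟨D''.carrier, δ, ∅, ∅⟩ : DiscreteDobrushin).zdBoundary \ P) :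
    (P ∪ Q = (⟨D''.carrier, δ, ∅, ∅⟩ : DiscreteDobrushin).zdBoundary ∧
      Disjoint P Q ∧ P.Nonempty ∧ Q.Nonempty ∧
      (∀ y ∈ P, infDist (meshPoint δ y) (D''.arc 0) ≤ ε) ∧
      (∀ x ∈ Q, infDist (meshPoint δ x) (D''.arc 1) ≤ ε) ∧
      {e | e ∈ (discreteDomainGraph D''.carrier δ).edgeSet ∧ (∃ x ∈ e, x ∈ P) ∧ ∃ y ∈ e, y ∈ Q}.ncard = 2 ∧
      ∀ e ∈ (discreteDomainGraph D''.carrier δ).edgeSet, (∃ x ∈ e, x ∈ P) → (∃ y ∈ e, y ∈ Q) →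
        ∃! f, (⟨D''.carrier, δ, ∅, ∅⟩ : DiscreteDobrushin).IsInnerFace f ∧ ∀ x ∈ e, IsCorner x f) ∧
    (∀ v : Site 2, (∀ z ∈ closure (D.carrier \ D''.carrier), θ ≤ dist (meshPoint δ v) z) →
      (v ∈ P ↔ v ∈ SA) ∧ (v ∈ Q ↔ v ∈ SB)) ∧
    (∀ v : Site 2, (¬ ∀ z ∈ closure (D.carrier \ D''.carrier), θ ≤ dist (meshPoint δ v) z) →
      (v ∈ P ↔ v ∈ SA') ∧ (v ∈ Q ↔ v ∈ SB')) ∧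
    (∀ x ∈ ea, ∀ z ∈ closure (D.carrier \ D''.carrier), 2 * θ ≤ dist (meshPoint δ x) z) ∧
    (∀ y ∈ (⟨D''.carrier, δ, ∅, ∅⟩ : DiscreteDobrushin).zdBoundary,
      (∀ z ∈ closure (D.carrier \ D''.carrier), θ / 2 ≤ dist (meshPoint δ y) z) →
      infDist (meshPoint δ y) (frontier D''.carrier) = infDist (meshPoint δ y) (frontier D.carrier)) ∧
    ∃ e2 : Sym2 (Site 2),
      {e | e ∈ (discreteDomainGraph D''.carrier δ).edgeSet ∧ (∃ x ∈ e, x ∈ P) ∧ ∃ y ∈ e, y ∈ Q} = {ea, e2} ∧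
      ea ≠ e2 ∧ dist (medialPoint δ e2) (D.pt 1) ≤ ε := by
  -- notation
  set F : Set ℂ := closure (D.carrier \ D''.carrier) with hF
  set bd := (⟨D.carrier, δ, ∅, ∅⟩ : DiscreteDobrushin).zdBoundary with hbd
  set bd'' := (⟨D''.carrier, δ, ∅, ∅⟩ : DiscreteDobrushin).zdBoundary with hbd''
  set a := D.pt 0 with haD
  set b := D.pt 1 with hbD
  have hδ0 : 0 ≤ δ := hδ.le
  have hθ : 0 < θ := by linarith
  -- membership bookkeeping
  have hSA : SA ⊆ bd := hU ▸ subset_union_left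
  have hSB : SB ⊆ bd := hU ▸ subset_union_right
  have hSA' : SA' ⊆ bd'' := hU' ▸ subset_union_left
  have hSB' : SB' ⊆ bd'' := hU' ▸ subset_union_right
  have hbdU : ∀ x ∈ bd, x ∈ SA ∨ x ∈ SB := fun x hx => by rw [← hU] at hx; exact hx
  have hbdU' : ∀ x ∈ bd'', x ∈ SA' ∨ x ∈ SB' := fun x hx => by rw [← hU'] at hx; exact hx
  have hPbd : P ⊆ bd'' := fun y hy => by rw [hP] at hy; exact hy.1
  have hQbd : Q ⊆ bd'' := fun x hx => by rw [hQ] at hx; exact hx.1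
  have hQiff : ∀ x, x ∈ Q ↔ x ∈ bd'' ∧ x ∉ P := fun x => by rw [hQ]; rfl
  have hbdM : bd ⊆ meshDomain D.carrier δ := DiscreteDobrushin.zdBoundary_subset_meshDomain _
  have hbdM'' : bd'' ⊆ meshDomain D''.carrier δ := DiscreteDobrushin.zdBoundary_subset_meshDomain _
  -- farness bookkeeping: monotone in the threshold, stable under small moves
  have far_mono : ∀ {v : Site 2} {s t : ℝ}, (∀ z ∈ F, t ≤ dist (meshPoint δ v) z) → s ≤ t →
      ∀ z ∈ F, s ≤ dist (meshPoint δ v) z := fun h hst z hz => hst.trans (h z hz)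
  have far_move : ∀ {v w : Site 2} {t s : ℝ}, (∀ z ∈ F, t ≤ dist (meshPoint δ v) z) →
      dist (meshPoint δ w) (meshPoint δ v) ≤ s → ∀ z ∈ F, t - s ≤ dist (meshPoint δ w) z :=
    fun h hd => far_of_dist_le h hd
  -- (T1)–(T3): lattice locality at `θ/2`-far sites
  have hMM2 : ∀ v, (∀ z ∈ F, θ / 2 ≤ dist (meshPoint δ v) z) →
      (v ∈ meshDomain D.carrier δ ↔ v ∈ meshDomain D''.carrier δ) :=
    fun v hv => hMM v (far_mono hv (by linarith))
  have hbd_iff : ∀ v, (∀ z ∈ F, θ / 2 ≤ dist (meshPoint δ v) z) → (v ∈ bd ↔ v ∈ bd'') := by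
    intro v hv
    have h4 : ∀ z ∈ F, 4 * δ ≤ dist (meshPoint δ v) z := far_mono hv (by linarith)
    constructor
    · intro h
      have hM := hbdM h
      exact (mem_zdBoundary_iff_of_far' hsub hδ h4 hM ((hMM2 v hv).1 hM)).1 h
    · intro h
      have hM'' := hbdM'' h
      exact (mem_zdBoundary_iff_of_far' hsub hδ h4 ((hMM2 v hv).2 hM'') hM'').2 h
  have hedge_iff : ∀ v, (∀ z ∈ F, θ / 2 ≤ dist (meshPoint δ v) z) → v ∈ meshDomain D.carrier δ → ∀ w,
      (s(v, w) ∈ (discreteDomainGraph D.carrier δ).edgeSet ↔ s(v, w) ∈ (discreteDomainGraph D''.carrier δ).edgeSet) :=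
    fun v hv hM w => mk_mem_edgeSet_iff_of_far' hsub hδ (far_mono hv (by linarith)) hM ((hMM2 v hv).1 hM)
  have hface_iff : ∀ v, (∀ z ∈ F, θ / 2 ≤ dist (meshPoint δ v) z) → v ∈ meshDomain D.carrier δ → ∀ f,
      IsCorner v f → ((⟨D.carrier, δ, ∅, ∅⟩ : DiscreteDobrushin).IsInnerFace f ↔
        (⟨D''.carrier, δ, ∅, ∅⟩ : DiscreteDobrushin).IsInnerFace f) :=
    fun v hv hM f hf => isInnerFace_iff_of_far' hsub hδ hf (far_mono hv (by linarith)) hM ((hMM2 v hv).1 hM)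
  -- (T4): radii agree at far boundary sites of `D''`
  have hrad : ∀ y ∈ bd'', (∀ z ∈ F, θ / 2 ≤ dist (meshPoint δ y) z) →
      infDist (meshPoint δ y) (frontier D''.carrier) = infDist (meshPoint δ y) (frontier D.carrier) := by
    intro y hy hfar
    refine infDist_frontier_eq_of_far' D.toJordanDomain D''.toJordanDomain hsub fun z hz => ?_
    have := infDist_frontier_le_two_mul D''.toJordanDomain hδ hy
    have := hfar z hz
    linarith
  -- (T5): sides transfer to the arcs of `D''` at far sites
  have hside0 : ∀ y : Site 2, infDist (meshPoint δ y) (D.arc 0) ≤ ε → (∀ z ∈ F, θ / 2 ≤ dist (meshPoint δ y) z) →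
      infDist (meshPoint δ y) (D''.arc 0) ≤ ε := fun y hy hfar =>
    infDist_arc_le_of_compatible D 0 hA0 hy fun z hz => by have := hfar z hz; linarith
  have hside1 : ∀ x : Site 2, infDist (meshPoint δ x) (D.arc 1) ≤ ε → (∀ z ∈ F, θ / 2 ≤ dist (meshPoint δ x) z) →
      infDist (meshPoint δ x) (D''.arc 1) ≤ ε := fun x hx hfar =>
    infDist_arc_le_of_compatible D 1 hA1 hx fun z hz => by have := hfar z hz; linarith
  -- membership in the patched labels
  have hP_far : ∀ y, (∀ z ∈ F, θ ≤ dist (meshPoint δ y) z) → (y ∈ P ↔ y ∈ SA) := by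
    intro y hfar
    rw [hP]
    constructor
    · rintro ⟨-, ⟨h, -⟩ | ⟨-, h⟩⟩
      · exact h
      · exact absurd hfar h
    · intro h
      exact ⟨(hbd_iff y (far_mono hfar (by linarith))).1 (hSA h), Or.inl ⟨h, hfar⟩⟩
  have hQ_far : ∀ x, (∀ z ∈ F, θ ≤ dist (meshPoint δ x) z) → (x ∈ Q ↔ x ∈ SB) := by
    intro x hfar
    rw [hQiff, hP_far x hfar, ← hbd_iff x (far_mono hfar (by linarith))]
    constructor
    · rintro ⟨hxbd, hxA⟩
      exact (hbdU x hxbd).resolve_left hxA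
    · intro h
      exact ⟨hSB h, fun h' => Set.disjoint_left.1 hdj h' h⟩
  have hP_near : ∀ y, (¬ ∀ z ∈ F, θ ≤ dist (meshPoint δ y) z) → (y ∈ P ↔ y ∈ SA') := by
    intro y hnear
    rw [hP]
    constructor
    · rintro ⟨-, ⟨-, h⟩ | ⟨h, -⟩⟩
      · exact absurd h hnear
      · exact h
    · intro h
      exact ⟨hSA' h, Or.inr ⟨h, hnear⟩⟩
  have hQ_near : ∀ x, (¬ ∀ z ∈ F, θ ≤ dist (meshPoint δ x) z) → (x ∈ Q ↔ x ∈ SB') := by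
    intro x hnear
    rw [hQiff, hP_near x hnear]
    constructor
    · rintro ⟨hxbd, hxA⟩
      exact (hbdU' x hxbd).resolve_left hxA
    · intro h
      exact ⟨hSB' h, fun h' => Set.disjoint_left.1 hdj' h' h⟩
  -- sides of the patched labels
  have hsP : ∀ y ∈ P, infDist (meshPoint δ y) (D''.arc 0) ≤ ε := by
    intro y hy
    by_cases hfar : ∀ z ∈ F, θ ≤ dist (meshPoint δ y) z
    · exact hside0 y (hsA y ((hP_far y hfar).1 hy)) (far_mono hfar (by linarith))
    · exact hsA' y ((hP_near y hfar).1 hy)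
  have hsQ : ∀ x ∈ Q, infDist (meshPoint δ x) (D''.arc 1) ≤ ε := by
    intro x hx
    by_cases hfar : ∀ z ∈ F, θ ≤ dist (meshPoint δ x) z
    · exact hside1 x (hsB x ((hQ_far x hfar).1 hx)) (far_mono hfar (by linarith))
    · exact hsB' x ((hQ_near x hfar).1 hx)
  -- separation at the seam: a `P`-site and a `Q`-site two meshes apart are near `a` or near `b`
  have hsep : ∀ y ∈ P, ∀ x ∈ Q, dist (meshPoint δ y) (meshPoint δ x) ≤ 2 * δ →
      θ / 2 ≤ dist (meshPoint δ y) a → θ / 2 ≤ dist (meshPoint δ y) b → False := by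
    intro y hy x hx hd hya hyb
    refine hμ (meshPoint δ y) hya hyb ((hsP y hy).trans (by linarith)) ?_
    have := infDist_le_infDist_add_dist (s := D''.arc 1) (x := meshPoint δ y) (y := meshPoint δ x)
    linarith [hsQ x hx]
  have hsep' : ∀ x ∈ Q, ∀ y ∈ P, dist (meshPoint δ x) (meshPoint δ y) ≤ 2 * δ →
      θ / 2 ≤ dist (meshPoint δ x) a → θ / 2 ≤ dist (meshPoint δ x) b → False := by
    intro x hx y hy hd hxa hxb
    refine hμ (meshPoint δ x) hxa hxb ?_ ((hsQ x hx).trans (by linarith))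
    have := infDist_le_infDist_add_dist (s := D''.arc 0) (x := meshPoint δ x) (y := meshPoint δ y)
    linarith [hsP y hy]
  -- positions: near `a` (or near a far `b`) is deep far; near `b ∈ F` is deep near
  have hnear_a : ∀ {p : ℂ}, dist p a < θ / 2 → ∀ z ∈ F, 2 * θ ≤ dist p z := by
    intro p hp z hz
    linarith [ha z hz, dist_triangle a p z, dist_comm a p]
  have hnear_b_far : ∀ {p : ℂ}, dist p b < θ / 2 → (∀ z ∈ F, 3 * θ ≤ dist b z) → ∀ z ∈ F, 2 * θ ≤ dist p z := by
    intro p hp hbf z hz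
    linarith [hbf z hz, dist_triangle b p z, dist_comm b p]
  have hnear_b_in : ∀ {p q : ℂ}, dist p b < θ / 2 → b ∈ F → dist q p ≤ 4 * δ → ¬ ∀ z ∈ F, θ ≤ dist q z := by
    intro p q hp hbF hqp h
    have := h b hbF
    linarith [dist_triangle q p b]
  -- the cut edge `e_a`: ends `pa ∈ SA`, `qa ∈ SB`, deep far
  have hea_mem : ea ∈ {e | e ∈ (discreteDomainGraph D.carrier δ).edgeSet ∧ (∃ x ∈ e, x ∈ SA) ∧
      ∃ y ∈ e, y ∈ SB} := by rw [hAB]; exact Or.inl rfl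
  obtain ⟨hea_e, ⟨pa, hpa, hpaA⟩, ⟨qa, hqa, hqaB⟩⟩ := hea_mem
  have hend_a : ∀ p ∈ ea, dist (meshPoint δ p) a < θ / 2 := fun p hp => by
    have := dist_medialPoint_le_of_mem hδ0 hea_e hp
    linarith [dist_triangle (meshPoint δ p) (medialPoint δ ea) a]
  have hea_far : ∀ p ∈ ea, ∀ z ∈ F, 2 * θ ≤ dist (meshPoint δ p) z := fun p hp => hnear_a (hend_a p hp)
  have hpaP : pa ∈ P := (hP_far pa (far_mono (hea_far pa hpa) (by linarith))).2 hpaA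
  have hqaQ : qa ∈ Q := (hQ_far qa (far_mono (hea_far qa hqa) (by linarith))).2 hqaB
  have hea_e'' : ea ∈ (discreteDomainGraph D''.carrier δ).edgeSet := by
    have hpq : pa ≠ qa := fun h => Set.disjoint_left.1 hdj hpaA (h ▸ hqaB)
    have he_eq : ea = s(pa, qa) := (Sym2.mem_and_mem_iff hpq).1 ⟨hpa, hqa⟩
    rw [he_eq] at hea_e ⊢
    exact (hedge_iff pa (far_mono (hea_far pa hpa) (by linarith)) (hbdM (hSA hpaA)) qa).1 hea_e
  -- ends of two-coloured edges of `D` near `b` resp. `a`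
  have hend_b : ∀ p ∈ eb, dist (meshPoint δ p) b ≤ ε + δ / 2 := by
    have heb_mem : eb ∈ {e | e ∈ (discreteDomainGraph D.carrier δ).edgeSet ∧ (∃ x ∈ e, x ∈ SA) ∧
        ∃ y ∈ e, y ∈ SB} := by rw [hAB]; exact Or.inr rfl
    intro p hp
    have := dist_medialPoint_le_of_mem hδ0 heb_mem.1 hp
    linarith [dist_triangle (meshPoint δ p) (medialPoint δ eb) b]
  have hend_a' : ∀ p ∈ ea', dist (meshPoint δ p) a ≤ ε + δ / 2 := by
    have hea'_mem : ea' ∈ {e | e ∈ (discreteDomainGraph D''.carrier δ).edgeSet ∧ (∃ x ∈ e, x ∈ SA') ∧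
        ∃ y ∈ e, y ∈ SB'} := by rw [hAB']; exact Or.inl rfl
    intro p hp
    have := dist_medialPoint_le_of_mem hδ0 hea'_mem.1 hp
    linarith [dist_triangle (meshPoint δ p) (medialPoint δ ea') a]
  -- the two-coloured edges of the patched labelling: each is `e_a`, or `e_b` with `b` far, or `e_b'` with `b ∈ F`
  have hcut_sub : ∀ e ∈ (discreteDomainGraph D''.carrier δ).edgeSet, (∃ x ∈ e, x ∈ P) → (∃ y ∈ e, y ∈ Q) →
      e = ea ∨ (e = eb ∧ ∀ z ∈ F, 3 * θ ≤ dist b z) ∨ (e = eb' ∧ b ∈ F) := by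
    rintro e he ⟨u, hu, huP⟩ ⟨w, hw, hwQ⟩
    have huw : u ≠ w := fun h => ((hQiff w).1 hwQ).2 (h ▸ huP)
    have he_eq : e = s(u, w) := (Sym2.mem_and_mem_iff huw).1 ⟨hu, hw⟩
    have hd : dist (meshPoint δ u) (meshPoint δ w) = δ :=
      dist_eq_of_adj hδ0 ((SimpleGraph.mem_edgeSet _).1 (he_eq ▸ he))
    -- `u` is near `a` or near `b`
    have hpos : dist (meshPoint δ u) a < θ / 2 ∨ dist (meshPoint δ u) b < θ / 2 := by
      by_contra h
      push Not at h
      exact hsep u huP w hwQ (by linarith) h.1 h.2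
    -- the deep-far case: an `SA`–`SB` edge of `Ω_δ(D)`
    have hfar_case : (∀ z ∈ F, 2 * θ ≤ dist (meshPoint δ u) z) → e = ea ∨ e = eb := by
      intro hufar
      have hwfar : ∀ z ∈ F, θ ≤ dist (meshPoint δ w) z := by
        have := far_move hufar (show dist (meshPoint δ w) (meshPoint δ u) ≤ δ by rw [dist_comm, hd])
        exact far_mono this (by linarith)
      have huA : u ∈ SA := (hP_far u (far_mono hufar (by linarith))).1 huP
      have hwB : w ∈ SB := (hQ_far w hwfar).1 hwQ
      have heD : e ∈ (discreteDomainGraph D.carrier δ).edgeSet := by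
        rw [he_eq] at he ⊢
        exact (hedge_iff u (far_mono hufar (by linarith)) (hbdM (hSA huA)) w).2 he
      have hmem : e ∈ ({ea, eb} : Set (Sym2 (Site 2))) := by
        rw [← hAB]; exact ⟨heD, ⟨u, hu, huA⟩, ⟨w, hw, hwB⟩⟩
      simpa only [mem_insert_iff, mem_singleton_iff] using hmem
    rcases hpos with hua | hub
    · -- near `a`: the edge is `e_a`
      rcases hfar_case (hnear_a hua) with h | h
      · exact Or.inl h
      · exfalso
        have := hend_b u (h ▸ hu)
        linarith [dist_triangle a (meshPoint δ u) b, dist_comm a (meshPoint δ u)]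
    · rcases hb with hbF | hbfar
      · -- near `b ∈ F`: an `SA'`–`SB'` edge, hence `e_b'`
        right; right
        have hunear : ¬ ∀ z ∈ F, θ ≤ dist (meshPoint δ u) z :=
          hnear_b_in hub hbF (by rw [dist_self]; linarith)
        have hwnear : ¬ ∀ z ∈ F, θ ≤ dist (meshPoint δ w) z :=
          hnear_b_in hub hbF (by rw [dist_comm, hd]; linarith)
        have huA' : u ∈ SA' := (hP_near u hunear).1 huP
        have hwB' : w ∈ SB' := (hQ_near w hwnear).1 hwQ
        have hmem : e ∈ ({ea', eb'} : Set (Sym2 (Site 2))) := by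
          rw [← hAB']; exact ⟨he, ⟨u, hu, huA'⟩, ⟨w, hw, hwB'⟩⟩
        rcases hmem with h | h
        · exfalso
          have := hend_a' u (h ▸ hu)
          linarith [dist_triangle a (meshPoint δ u) b, dist_comm a (meshPoint δ u)]
        · exact ⟨h, hbF⟩
      · -- near a far `b`: the edge is `e_b`
        rcases hfar_case (hnear_b_far hub hbfar) with h | h
        · exfalso
          have := hend_a u (h ▸ hu)
          linarith [dist_triangle a (meshPoint δ u) b, dist_comm a (meshPoint δ u)]
        · exact Or.inr (Or.inl ⟨h, hbfar⟩)
  -- the second cut edge and the cut set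
  obtain ⟨e2, hcut, hne2, he2b, he2inner⟩ : ∃ e2 : Sym2 (Site 2),
      {e | e ∈ (discreteDomainGraph D''.carrier δ).edgeSet ∧ (∃ x ∈ e, x ∈ P) ∧ ∃ y ∈ e, y ∈ Q} = {ea, e2} ∧
      ea ≠ e2 ∧ dist (medialPoint δ e2) b ≤ ε ∧
      ∃! f, (⟨D''.carrier, δ, ∅, ∅⟩ : DiscreteDobrushin).IsInnerFace f ∧ ∀ x ∈ e2, IsCorner x f := by
    have hea_in : ea ∈ {e | e ∈ (discreteDomainGraph D''.carrier δ).edgeSet ∧ (∃ x ∈ e, x ∈ P) ∧ ∃ y ∈ e, y ∈ Q} :=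
      ⟨hea_e'', ⟨pa, hpa, hpaP⟩, ⟨qa, hqa, hqaQ⟩⟩
    have hne_of_near_b : ∀ {e : Sym2 (Site 2)}, dist (medialPoint δ e) b ≤ ε → ea ≠ e := by
      intro e he h
      rw [← h] at he
      linarith [dist_triangle a (medialPoint δ ea) b, dist_comm a (medialPoint δ ea)]
    rcases hb with hbF | hbfar
    · -- `b ∈ F`: the second cut edge is `e_b'`
      have heb'_mem : eb' ∈ {e | e ∈ (discreteDomainGraph D''.carrier δ).edgeSet ∧ (∃ x ∈ e, x ∈ SA') ∧
          ∃ y ∈ e, y ∈ SB'} := by rw [hAB']; exact Or.inr rfl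
      obtain ⟨heb'_e, ⟨p', hp', hp'A⟩, ⟨q', hq', hq'B⟩⟩ := heb'_mem
      have hnear' : ∀ p ∈ eb', ¬ ∀ z ∈ F, θ ≤ dist (meshPoint δ p) z := by
        intro p hp h
        have h1 := dist_medialPoint_le_of_mem hδ0 heb'_e hp
        have h2 := h b hbF
        linarith [dist_triangle (meshPoint δ p) (medialPoint δ eb') b]
      refine ⟨eb', Subset.antisymm ?_ ?_, hne_of_near_b heb', heb', hinner' eb' heb'_e ⟨p', hp', hp'A⟩ ⟨q', hq', hq'B⟩⟩
      · intro e he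
        rcases hcut_sub e he.1 he.2.1 he.2.2 with h | ⟨-, h⟩ | ⟨h, -⟩
        · exact Or.inl h
        · exfalso
          have := h b hbF
          rw [dist_self] at this
          linarith
        · exact Or.inr h
      · rintro e (rfl | rfl)
        · exact hea_in
        · exact ⟨heb'_e, ⟨p', hp', (hP_near p' (hnear' p' hp')).2 hp'A⟩, ⟨q', hq', (hQ_near q' (hnear' q' hq')).2 hq'B⟩⟩
    · -- `b` far: the second cut edge is `e_b`
      have heb_mem : eb ∈ {e | e ∈ (discreteDomainGraph D.carrier δ).edgeSet ∧ (∃ x ∈ e, x ∈ SA) ∧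
          ∃ y ∈ e, y ∈ SB} := by rw [hAB]; exact Or.inr rfl
      obtain ⟨heb_e, ⟨pb, hpb, hpbA⟩, ⟨qb, hqb, hqbB⟩⟩ := heb_mem
      have hebfar : ∀ p ∈ eb, ∀ z ∈ F, 2 * θ ≤ dist (meshPoint δ p) z := fun p hp =>
        hnear_b_far (by linarith [hend_b p hp]) hbfar
      have hpbP : pb ∈ P := (hP_far pb (far_mono (hebfar pb hpb) (by linarith))).2 hpbA
      have hqbQ : qb ∈ Q := (hQ_far qb (far_mono (hebfar qb hqb) (by linarith))).2 hqbB
      have hpq : pb ≠ qb := fun h => Set.disjoint_left.1 hdj hpbA (h ▸ hqbB)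
      have he_eq : eb = s(pb, qb) := (Sym2.mem_and_mem_iff hpq).1 ⟨hpb, hqb⟩
      have hpbfar2 : ∀ z ∈ F, θ / 2 ≤ dist (meshPoint δ pb) z := far_mono (hebfar pb hpb) (by linarith)
      have heb_e'' : eb ∈ (discreteDomainGraph D''.carrier δ).edgeSet := by
        rw [he_eq] at heb_e ⊢
        exact (hedge_iff pb hpbfar2 (hbdM (hSA hpbA)) qb).1 heb_e
      refine ⟨eb, Subset.antisymm ?_ ?_, hne_of_near_b heb, heb, ?_⟩
      · intro e he
        rcases hcut_sub e he.1 he.2.1 he.2.2 with h | ⟨h, -⟩ | ⟨-, h⟩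
        · exact Or.inl h
        · exact Or.inr h
        · exfalso
          have := hbfar b h
          rw [dist_self] at this
          linarith
      · rintro e (rfl | rfl)
        · exact hea_in
        · exact ⟨heb_e'', ⟨pb, hpb, hpbP⟩, ⟨qb, hqb, hqbQ⟩⟩
      · exact (existsUnique_inner_congr fun f hf => hface_iff pb hpbfar2 (hbdM (hSA hpbA)) f (hf pb hpb)).1
          (hinner eb heb_e ⟨pb, hpb, hpbA⟩ ⟨qb, hqb, hqbB⟩)
  -- inner faces of the cut edges
  have hinnerPQ : ∀ e ∈ (discreteDomainGraph D''.carrier δ).edgeSet, (∃ x ∈ e, x ∈ P) → (∃ y ∈ e, y ∈ Q) →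
      ∃! f, (⟨D''.carrier, δ, ∅, ∅⟩ : DiscreteDobrushin).IsInnerFace f ∧ ∀ x ∈ e, IsCorner x f := by
    intro e he hx hy
    have hmem : e ∈ ({ea, e2} : Set (Sym2 (Site 2))) := by rw [← hcut]; exact ⟨he, hx, hy⟩
    rcases hmem with rfl | rfl
    · exact (existsUnique_inner_congr fun f hf => hface_iff pa (far_mono (hea_far pa hpa) (by linarith))
        (hbdM (hSA hpaA)) f (hf pa hpa)).1 (hinner _ hea_e ⟨pa, hpa, hpaA⟩ ⟨qa, hqa, hqaB⟩)
    · exact he2inner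
  refine ⟨⟨?_, ?_, ⟨pa, hpaP⟩, ⟨qa, hqaQ⟩, hsP, hsQ, by rw [hcut, ncard_pair hne2], hinnerPQ⟩,
    fun v hv => ⟨hP_far v hv, hQ_far v hv⟩, fun v hv => ⟨hP_near v hv, hQ_near v hv⟩, hea_far, hrad,
    e2, hcut, hne2, he2b⟩
  · -- union
    refine Subset.antisymm (union_subset hPbd hQbd) fun x hx => ?_
    by_cases h : x ∈ P
    · exact Or.inl h
    · exact Or.inr ((hQiff x).2 ⟨hx, h⟩)
  · exact Set.disjoint_left.2 fun x hxP hxQ => ((hQiff x).1 hxQ).2 hxP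

/-! ### Registered sub-goal (one-line signature, verbatim) -/

/-- **Registered sub-goal `stub_discreteLocality_patchCut` of `stub_discreteLocality`**: the patch of the two labellings, part I (`locality_patch_cut`), fully
quantified. -/
theorem stub_discreteLocality_patchCut : ∀ (D D'' : DobrushinDomain), (D''.carrier ⊆ D.carrier) → (∀ z ∈ D.arc 0, z ∉ closure (D.carrier \ D''.carrier) → z ∈ D''.arc 0) → (∀ z ∈ D.arc 1, z ∉ closure (D.carrier \ D''.carrier) → z ∈ D''.arc 1) → ∀ (δ ε θ μ : ℝ), (0 < δ) → (∀ z : ℂ, θ / 2 ≤ dist z (D.pt 0) → θ / 2 ≤ dist z (D.pt 1) → infDist z (D''.arc 0) ≤ μ → infDist z (D''.arc 1) ≤ μ → False) → (∀ z ∈ closure (D.carrier \ D''.carrier), 3 * θ ≤ dist (D.pt 0) z) → (D.pt 1 ∈ closure (D.carrier \ D''.carrier) ∨ ∀ z ∈ closure (D.carrier \ D''.carrier), 3 * θ ≤ dist (D.pt 1) z) → (2 * θ ≤ dist (D.pt 0) (D.pt 1)) → (ε + 2 * δ ≤ μ) → (16 * δ ≤ θ) → (4 * ε ≤ θ) → (∀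 v : Site 2, (∀ z ∈ closure (D.carrier \ D''.carrier), θ / 4 ≤ dist (meshPoint δ v) z) → (v ∈ meshDomain D.carrier δ ↔ v ∈ meshDomain D''.carrier δ)) → ∀ (SA SB SA' SB' P Q : Set (Site 2)), ∀ (ea eb ea' eb' : Sym2 (Site 2)), (SA ∪ SB = (⟨D.carrier, δ, ∅, ∅⟩ : DiscreteDobrushin).zdBoundary) → (Disjoint SA SB) → (∀ y ∈ SA, infDist (meshPoint δ y) (D.arc 0) ≤ ε) → (∀ x ∈ SB, infDist (meshPoint δ x) (D.arc 1) ≤ ε) → ({e | e ∈ (discreteDomainGraph D.carrier δ).edgeSet ∧ (∃ x ∈ e, x ∈ SA) ∧ ∃ y ∈ e, y ∈ SB} = {ea, eb}) → (dist (medialPoint δ ea) (D.pt 0) ≤ ε) → (dist (medialPoint δ eb) (D.pt 1) ≤ ε) → (∀ e ∈ (discreteDomainGraph D.carrier δ).edgeSet, (∃ x ∈ e, x ∈ SA) → (∃ y ∈ e, y ∈ SB) → ∃! f, (⟨D.carrier, δ, ∅, ∅⟩ : DiscreteDobrushin).IsInnerFace f ∧ ∀ x ∈ e, IsCorner x f)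 → (SA' ∪ SB' = (⟨D''.carrier, δ, ∅, ∅⟩ : DiscreteDobrushin).zdBoundary) → (Disjoint SA' SB') → (∀ y ∈ SA', infDist (meshPoint δ y) (D''.arc 0) ≤ ε) → (∀ x ∈ SB', infDist (meshPoint δ x) (D''.arc 1) ≤ ε) → ({e | e ∈ (discreteDomainGraph D''.carrier δ).edgeSet ∧ (∃ x ∈ e, x ∈ SA') ∧ ∃ y ∈ e, y ∈ SB'} = {ea', eb'}) → (dist (medialPoint δ ea') (D.pt 0) ≤ ε) → (dist (medialPoint δ eb') (D.pt 1) ≤ ε) → (∀ e ∈ (discreteDomainGraph D''.carrier δ).edgeSet, (∃ x ∈ e, x ∈ SA') → (∃ y ∈ e, y ∈ SB') → ∃! f, (⟨D''.carrier, δ, ∅, ∅⟩ : DiscreteDobrushin).IsInnerFace f ∧ ∀ x ∈ e, IsCorner x f) → (P = {y | y ∈ (⟨D''.carrier, δ, ∅, ∅⟩ : DiscreteDobrushin).zdBoundary ∧ ((y ∈ SA ∧ ∀ z ∈ closure (D.carrier \ D''.carrier), θ ≤ dist (meshPoint δ y) z) ∨ (y ∈ SA' ∧ ¬ ∀ z ∈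 closure (D.carrier \ D''.carrier), θ ≤ dist (meshPoint δ y) z))}) → (Q = (⟨D''.carrier, δ, ∅, ∅⟩ : DiscreteDobrushin).zdBoundary \ P) → (P ∪ Q = (⟨D''.carrier, δ, ∅, ∅⟩ : DiscreteDobrushin).zdBoundary ∧ Disjoint P Q ∧ P.Nonempty ∧ Q.Nonempty ∧ (∀ y ∈ P, infDist (meshPoint δ y) (D''.arc 0) ≤ ε) ∧ (∀ x ∈ Q, infDist (meshPoint δ x) (D''.arc 1) ≤ ε) ∧ {e | e ∈ (discreteDomainGraph D''.carrier δ).edgeSet ∧ (∃ x ∈ e, x ∈ P) ∧ ∃ y ∈ e, y ∈ Q}.ncard = 2 ∧ ∀ e ∈ (discreteDomainGraph D''.carrier δ).edgeSet, (∃ x ∈ e, x ∈ P) → (∃ y ∈ e, y ∈ Q) → ∃! f, (⟨D''.carrier, δ, ∅, ∅⟩ : DiscreteDobrushin).IsInnerFace f ∧ ∀ x ∈ e, IsCorner x f) ∧ (∀ v : Site 2, (∀ z ∈ closure (D.carrier \ D''.carrier), θ ≤ dist (meshPoint δ v) z) → (v ∈ P ↔ v ∈ SA) ∧ (v ∈ Q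 ↔ v ∈ SB)) ∧ (∀ v : Site 2, (¬ ∀ z ∈ closure (D.carrier \ D''.carrier), θ ≤ dist (meshPoint δ v) z) → (v ∈ P ↔ v ∈ SA') ∧ (v ∈ Q ↔ v ∈ SB')) ∧ (∀ x ∈ ea, ∀ z ∈ closure (D.carrier \ D''.carrier), 2 * θ ≤ dist (meshPoint δ x) z) ∧ (∀ y ∈ (⟨D''.carrier, δ, ∅, ∅⟩ : DiscreteDobrushin).zdBoundary, (∀ z ∈ closure (D.carrier \ D''.carrier), θ / 2 ≤ dist (meshPoint δ y) z) → infDist (meshPoint δ y) (frontier D''.carrier) = infDist (meshPoint δ y) (frontier D.carrier)) ∧ ∃ e2 : Sym2 (Site 2), {e | e ∈ (discreteDomainGraph D''.carrier δ).edgeSet ∧ (∃ x ∈ e, x ∈ P) ∧ ∃ y ∈ e, y ∈ Q} = {ea, e2} ∧ ea ≠ e2 ∧ dist (medialPoint δ e2) (D.pt 1) ≤ ε :=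
  fun D D'' hsub hA0 hA1 _ _ _ _ hδ hμ ha hb hab hεμ hδθ hεθ hMM _ _ _ _ _ _ _ _ _ _ hU hdj hsA hsB hAB hea heb hinner hU' hdj' hsA' hsB' hAB' hea' heb' hinner' hP hQ => locality_patch_cut D D'' hsub hA0 hA1 hδ hμ ha hb hab hεμ hδθ hεθ hMM hU hdj hsA hsB hAB hea heb hinner hU' hdj' hsA' hsB' hAB' hea' heb' hinner' hP hQ

end Summit.CriticalPhenomena.CardyFormulaZ2.Cruxes.LagHandOff.HittingTournament

end
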